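import Mathlib
import Summits.ValiantsHypothesis.ValiantsHypothesis.Theorems.LiouvilleSarnakAlignedTypeICharactersMod2nKMTOnly
import Literature.NumberTheory.Sieve.HalaszMontgomeryTenenbaumProofs
import Literature.NumberTheory.LFunctions.PretentiousZeta
import Literature.NumberTheory.LFunctions.DirichletLFunctionInverseBound
import Literature.NumberTheory.LFunctions.TaoLogElliottUnimodular
import HarnessLib

/-!
# Route LiouvilleSarnak — support `AlignedTypeI` (stmt-ValiantsHypothesis-21040), line `characters_mod_2n`:
# the registered stub `stub_twistedLiouvilleSmall` at LINEAR depth, unconditionally (Halász)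

The registered stub `stub_twistedLiouvilleSmall : TwistedLiouvilleSmall` asks that
`‖Σ_{m ≤ 2^(n+k)} λ(m) χ(m)‖ ≤ ε 2^(n+k)` for all `n ≥ n₀(ε)`, ALL levels `k ≤ n` and all Dirichlet characters
`χ` mod `2^k`.  The tree's `…CharactersMod2nTwistedLiouville.lean` proves it in the Green range `k ≤ c'√n`
(modulus `2^k ≤ e^{c√log x}`, classical zero-free region).  This file proves it for all levels
`k ≤ δ(ε) · n` — modulus `2^k ≤ x^{δ'}` for a positive power `δ' = δ/(1+δ)` depending on `ε` — from four PROVED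
tree theorems and nothing else:

* Halász's theorem in the Halász–Montgomery–Tenenbaum form (`Sieve.halaszMontgomeryTenenbaum_holds`):
  `‖Σ_{m ≤ x} f(m)‖ ≤ C x ((1 + M) e^{-M} + T^{-1/2})`, `M = min_{|t| ≤ T} 𝔻(f, n^{it}; x)²`, applied to the
  completely multiplicative `f = λχ`;
* the distance formula `𝔻(1, ψ(n)n^{it}; x)² = log log x − log |L(σ_x − it, ψ)| + O(1)`
  (`LFunctions.exists_pretentiousDistSq_one_twistedChar_approx`) and Mertens
  (`LFunctions.exists_abs_sum_primesLE_inv_sub_loglog_le`), which give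
  `𝔻(λχ, n^{it}; x)² = 2 Σ_{p ≤ x} 1/p − 𝔻(1, χ̄(n)n^{it}; x)² = log log x + log |L(σ_x − it, χ̄)| + O(1)`;
* Montgomery–Vaughan Theorem 11.4 (11.7) (`LFunctions.DirichletZFR.exists_inv_LFunction_bounds`):
  `1/|L(s, ψ)| ≪ log q + log(|t|+4)` for `σ ≥ 1 − c/ℒ` and every COMPLEX `ψ` mod `q` (a complex character has no
  exceptional zero, by the same theorem's description of the zeros near `1`);
* for the REAL characters mod `2^k` (which factor through `8`): the tree's Green-range bound
  (`twisted_le_of_sq_eq_one`, `twisted_norm_le_of_level_le`).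

Hence `M ≥ log log x − log(log 2^k + log(T+4)) − O(1) ≥ log(1/(2δ)) − O(1)` for `x = 2^(n+k)`, `k ≤ δ n`, and
Halász gives `‖Σ λχ‖ ≤ ε x` once `δ = δ(ε)` is small and `T = T(ε)` is large.

Results: `exists_liouville_mul_char` (the multiplicative function `λχ`), `pretentiousDistSq_liouville_mul_char`
(the distance identity), `exists_log_norm_LSeries_ge` (`log |L(s, ψ)| ≥ −log(C₁ ℒ)`, `σ > 1`, `ψ` complex),
`exists_pretentiousDistSq_ge` (`𝔻(λχ, n^{it}; x)² ≥ log log x − log ℒ − C₀`), and the stub at linear depth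
`twisted_norm_le_of_level_le_linear`.

HONEST FRAMING.  This is `TwistedLiouvilleSmall` on the levels `k ≤ δ(ε) n` only; the registered statement asks
for all `k ≤ n` (there the only input in print is Banks–Shparlinski 2019 Thm 2.2, typed as the named fact
`BanksShparlinski2019_theorem22_twoPower`, no `_holds`), and the companion file `…KMTOnly.lean` shows this stub
is idle for the crux anyway.  `stub_twistedLiouvilleSmall` is NOT closed; `AlignedTypeI` is NOT closed; nothing
here bears on `VP ≠ VNP` (NOT proved).
-/

set_option linter.dupNamespace false

noncomputable section

namespace Summit.ValiantsHypothesis.ValiantsHypothesis.Theorems.LiouvilleSarnak.AlignedTypeI.CharactersModTwoN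

open ArithmeticFunction Finset Complex
open scoped BigOperators ComplexConjugate
open Literature.NumberTheory.Sieve (pretentiousDistSq twistedChar minPretentiousDistSq)
open Literature.NumberTheory.LFunctions (sigmaX one_lt_sigmaX)

/-! ## §1 The completely multiplicative function `λχ` -/

/-- `λχ` (for `χ` a Dirichlet character mod `q`) is a `1`-bounded multiplicative arithmetic function.
[folklore] -/
theorem exists_liouville_mul_char (q : ℕ) (χ : DirichletCharacter ℂ q) :
    ∃ f : ArithmeticFunction ℂ, f.IsMultiplicative ∧ (∀ n, ‖f n‖ ≤ 1) ∧
      ∀ n : ℕ, f n = ((liouville n : ℤ) : ℂ) * χ (n : ZMod q) := by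
  refine ⟨⟨fun n => ((liouville n : ℤ) : ℂ) * χ (n : ZMod q), by simp⟩, ⟨?_, ?_⟩, ?_, fun n => rfl⟩
  · show ((liouville 1 : ℤ) : ℂ) * χ ((1 : ℕ) : ZMod q) = 1
    rw [liouville_apply_one, Nat.cast_one, map_one, Int.cast_one, one_mul]
  · intro m n _
    show ((liouville (m * n) : ℤ) : ℂ) * χ ((m * n : ℕ) : ZMod q) =
      ((liouville m : ℤ) : ℂ) * χ (m : ZMod q) * (((liouville n : ℤ) : ℂ) * χ (n : ZMod q))
    rw [liouville_apply_mul, Nat.cast_mul, map_mul, Int.cast_mul]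
    ring
  · intro n
    show ‖((liouville n : ℤ) : ℂ) * χ (n : ZMod q)‖ ≤ 1
    rw [norm_mul]
    have h1 : ‖((liouville n : ℤ) : ℂ)‖ ≤ 1 := by
      rw [Complex.norm_intCast]
      exact_mod_cast abs_liouville_le_one n
    have h2 : ‖χ (n : ZMod q)‖ ≤ 1 := χ.norm_le_one _
    calc ‖((liouville n : ℤ) : ℂ)‖ * ‖χ (n : ZMod q)‖ ≤ 1 * 1 := mul_le_mul h1 h2 (norm_nonneg _) zero_le_one
      _ = 1 := one_mul 1

/-! ## §2 The distance identity `𝔻(λχ, n^{it})² = 2 Σ 1/p − 𝔻(1, χ̄(n) n^{it})²` -/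

/-- **Distance identity.**  If `f(p) = −χ(p)` at every prime `p` (e.g. `f = λχ`), then for all real `t, x`:
`𝔻(f, n^{it}; x)² = 2 Σ_{p ≤ x} 1/p − 𝔻(1, χ̄(n) n^{it}; x)²` (`χ̄ = χ⁻¹`; summand by summand,
`1 + Re(χ̄(p)p^{it}) = 2 − (1 − Re(χ̄(p)p^{it}))`). [folklore] -/
theorem pretentiousDistSq_liouville_mul_char {q : ℕ} [NeZero q] (χ : DirichletCharacter ℂ q) {f : ℕ → ℂ}
    (hf : ∀ p : ℕ, p.Prime → f p = -χ (p : ZMod q)) (t x : ℝ) :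
    pretentiousDistSq f (fun n : ℕ => (n : ℂ) ^ ((t : ℂ) * I)) x =
      2 * ∑ p ∈ Nat.primesLE ⌊x⌋₊, (p : ℝ)⁻¹ - pretentiousDistSq 1 (twistedChar χ⁻¹ t) x := by
  unfold Literature.NumberTheory.Sieve.pretentiousDistSq Literature.NumberTheory.Sieve.twistedChar
  rw [Finset.mul_sum, ← Finset.sum_sub_distrib]
  refine Finset.sum_congr rfl fun p hp => ?_
  have hpp : p.Prime := Nat.prime_of_mem_primesLE hp
  rw [hf p hpp]
  have hconj : conj (χ (p : ZMod q)) = χ⁻¹ (p : ZMod q) := by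
    rw [← MulChar.star_apply']
    rfl
  -- `Re(z · conj w) = Re(conj z · w)` (as `Literature.NumberTheory.LFunctions.WeilAna.re_mul_conj_eq`)
  have hre : ∀ z w : ℂ, (z * conj w).re = (conj z * w).re := fun z w => by
    simp only [Complex.mul_re, Complex.conj_re, Complex.conj_im]
    ring
  have h1 : (-χ (p : ZMod q) * conj ((p : ℂ) ^ ((t : ℂ) * I))).re =
      -(χ⁻¹ (p : ZMod q) * (p : ℂ) ^ ((t : ℂ) * I)).re := by
    rw [neg_mul, Complex.neg_re, hre, hconj]
  rw [h1]
  simp only [Pi.one_apply, one_mul, Complex.conj_re]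
  ring

/-! ## §3 `log |L(s, ψ)| ≥ −log(C₁ ℒ)` for complex `ψ`, `σ > 1` -/

/-- **No exceptional zero for complex characters, and the resulting lower bound.**  There is `C₁ > 0` such that
for every `q ≥ 1`, every Dirichlet character `ψ` mod `q` with `ψ² ≠ 1` and every `s` with `Re s > 1`:
`log ‖L(s, ψ)‖ ≥ −log(C₁ (log q + log(|Im s| + 4)))` (`L` = the Dirichlet series).  From Montgomery–Vaughan
Theorem 11.4: zeros with `Re ρ > 1 − 2c/ℒ_ρ` force `ψ² = 1`, so the hypothesis of (11.7) holds and
`‖1/L(s, ψ)‖ ≤ C ℒ` for `σ ≥ 1 − c/ℒ ⊇ {σ > 1}`. [cite: MontgomeryVaughan2007, Theorem 11.4 (11.7)] -/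
theorem exists_log_norm_LSeries_ge :
    ∃ C₁ : ℝ, 0 < C₁ ∧ ∀ (q : ℕ) [NeZero q] (ψ : DirichletCharacter ℂ q), ψ ^ 2 ≠ 1 →
      ∀ s : ℂ, 1 < s.re →
        -Real.log (C₁ * (Real.log q + Real.log (|s.im| + 4))) ≤
          Real.log ‖LSeries (fun n : ℕ => ψ n) s‖ := by
  obtain ⟨c, hc, _, C, hC0, hzfr, _, hA, _⟩ :=
    Literature.NumberTheory.LFunctions.DirichletZFR.exists_inv_LFunction_bounds
  refine ⟨max C 1, by positivity, fun q _ ψ hψ s hs => ?_⟩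
  have hψ1 : ψ ≠ 1 := fun h => hψ (by rw [h, one_pow])
  -- a complex character has no real zero near `1`
  have hnoreal : ∀ β : ℝ, ψ.LFunction β = 0 → β ≤ 1 - 2 * c / (Real.log q + Real.log 4) := by
    intro β hβ
    by_contra hlt
    have h := hzfr q ψ hψ1 (β : ℂ) hβ (by simpa using not_le.mp hlt)
    exact hψ h.1
  set ℒ : ℝ := Real.log q + Real.log (|s.im| + 4) with hℒ
  have hq0 : (0 : ℝ) ≤ Real.log q := Real.log_natCast_nonneg q
  have hlog4 : 0 < Real.log (|s.im| + 4) := Real.log_pos (by linarith [abs_nonneg s.im])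
  have hℒpos : 0 < ℒ := by rw [hℒ]; linarith
  have hreg : 1 - c / (Real.log q + Real.log (|s.im| + 4)) ≤ s.re := by
    have : 0 ≤ c / (Real.log q + Real.log (|s.im| + 4)) := div_nonneg hc.le hℒpos.le
    linarith
  obtain ⟨hne, hinv⟩ := hA q ψ hψ1 hnoreal s hreg
  rw [DirichletCharacter.LFunction_eq_LSeries ψ hs] at hne hinv
  set L : ℂ := LSeries (fun n : ℕ => ψ n) s with hL
  have hLpos : 0 < ‖L‖ := norm_pos_iff.mpr hne
  have hinv' : ‖L‖⁻¹ ≤ max C 1 * ℒ := by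
    rw [← norm_inv]
    exact hinv.trans (mul_le_mul_of_nonneg_right (le_max_left _ _) hℒpos.le)
  have hprod : 0 < max C 1 * ℒ := by positivity
  have hge : (max C 1 * ℒ)⁻¹ ≤ ‖L‖ := by
    rw [inv_le_comm₀ hprod hLpos]
    exact hinv'
  calc -Real.log (max C 1 * ℒ) = Real.log ((max C 1 * ℒ)⁻¹) := by rw [Real.log_inv]
    _ ≤ Real.log ‖L‖ := Real.log_le_log (inv_pos.mpr hprod) hge

/-! ## §4 `𝔻(λχ, n^{it}; x)² ≥ log log x − log ℒ − C₀` for complex `χ` -/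

/-- **Lower bound for the distance of `λχ` from `n^{it}`, `χ` complex.**  There are absolute `x₀ ≥ 3`, `C₀ ≥ 0`
with: for every `q ≥ 1`, every `χ` mod `q` with `χ² ≠ 1`, every `f` with `f(p) = −χ(p)` at primes, all `x ≥ x₀`
and all real `t`, `𝔻(f, n^{it}; x)² ≥ log log x − log(log q + log(|t| + 4)) − C₀`.  (§2, Mertens, the distance
formula for `𝔻(1, χ̄(n)n^{it}; x)²` and §3 at `s = σ_x − it`.) [folklore] -/
theorem exists_pretentiousDistSq_ge :
    ∃ x₀ C₀ : ℝ, 3 ≤ x₀ ∧ 0 ≤ C₀ ∧ ∀ (q : ℕ) [NeZero q] (χ : DirichletCharacter ℂ q), χ ^ 2 ≠ 1 →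
      ∀ f : ℕ → ℂ, (∀ p : ℕ, p.Prime → f p = -χ (p : ZMod q)) →
      ∀ x : ℝ, x₀ ≤ x → ∀ t : ℝ,
        Real.log (Real.log x) - Real.log (Real.log q + Real.log (|t| + 4)) - C₀ ≤
          pretentiousDistSq f (fun n : ℕ => (n : ℂ) ^ ((t : ℂ) * I)) x := by
  obtain ⟨x₁, Ca, hx₁, happrox⟩ :=
    Literature.NumberTheory.LFunctions.exists_pretentiousDistSq_one_twistedChar_approx
  obtain ⟨x₂, Cm, hx₂, hmertens⟩ :=
    Literature.NumberTheory.LFunctions.exists_abs_sum_primesLE_inv_sub_loglog_le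
  obtain ⟨C₁, hC₁, hL⟩ := exists_log_norm_LSeries_ge
  refine ⟨max x₁ x₂, 2 * |Cm| + |Ca| + |Real.log C₁|, le_trans hx₁ (le_max_left _ _), by positivity,
    fun q _ χ hχ f hf x hx t => ?_⟩
  have hxx₁ : x₁ ≤ x := le_trans (le_max_left _ _) hx
  have hxx₂ : x₂ ≤ x := le_trans (le_max_right _ _) hx
  have hx1 : (1 : ℝ) < x := by linarith
  -- the conjugate character is complex too
  have hχinv : χ⁻¹ ^ 2 ≠ 1 := by
    rw [inv_pow, ne_eq, inv_eq_one]
    exact hχ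
  -- §2
  rw [pretentiousDistSq_liouville_mul_char χ hf t x]
  -- Mertens
  have hM := hmertens x hxx₂
  rw [abs_le] at hM
  -- distance formula for `𝔻(1, χ̄ n^{it})²`
  have hD := happrox x hxx₁ q χ⁻¹ t
  rw [abs_le] at hD
  -- §3 at `s = σ_x - it`
  set s : ℂ := (sigmaX x : ℂ) - t * I with hs
  have hsre : 1 < s.re := by
    rw [hs]
    simpa using one_lt_sigmaX hx1
  have hsim : |s.im| = |t| := by
    rw [hs]
    simp
  have hLs := hL q χ⁻¹ hχinv s hsre
  rw [hsim] at hLs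
  -- `log(C₁ ℒ) = log C₁ + log ℒ`
  have hq0 : (0 : ℝ) ≤ Real.log q := Real.log_natCast_nonneg q
  have hlog4 : 0 < Real.log (|t| + 4) := Real.log_pos (by linarith [abs_nonneg t])
  have hℒpos : 0 < Real.log q + Real.log (|t| + 4) := by linarith
  rw [Real.log_mul hC₁.ne' hℒpos.ne'] at hLs
  have h1 : Real.log C₁ ≤ |Real.log C₁| := le_abs_self _
  have h2 : Cm ≤ |Cm| := le_abs_self _
  have h3 : Ca ≤ |Ca| := le_abs_self _
  -- the character values agree: `(χ⁻¹ : DirichletCharacter) n` in `happrox` is the one in `hL`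
  linarith [hD.2, hM.1, hLs]

/-! ## §5 The stub at linear depth -/

/-- **Twisted Liouville sums to `2`-power moduli at linear depth, unconditionally.**  For every `ε > 0` there are
`δ > 0` and `n₀` such that for all `n ≥ n₀`, every level `k` with `k ≤ δ n` and every Dirichlet character `χ`
mod `2^k`: `‖Σ_{m ≤ 2^(n+k)} λ(m) χ(m)‖ ≤ ε 2^(n+k)` — the registered `TwistedLiouvilleSmall` with its level
range `k ≤ n` cut down to `k ≤ δ(ε) n` (modulus up to the power `x^{δ/(1+δ)}` of the length `x = 2^(n+k)`).
Complex `χ`: Halász–Montgomery–Tenenbaum with `M ≥ log(1/(2δ)) − C₀`; real `χ`: the Green range.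
[cite: Mangerel2018, Theorem 1.1.5; MontgomeryVaughan2007, Theorem 11.4] -/
theorem twisted_norm_le_of_level_le_linear :
    ∀ ε : ℝ, 0 < ε → ∃ δ : ℝ, 0 < δ ∧ ∃ n₀ : ℕ, ∀ n ≥ n₀, ∀ k : ℕ, (k : ℝ) ≤ δ * n →
      ∀ χ : DirichletCharacter ℂ (2 ^ k),
        ‖∑ m : Fin (2 ^ (n + k)), ((liouville ((m : ℕ) + 1) : ℤ) : ℂ) *
            χ (((m : ℕ) + 1 : ℕ) : ZMod (2 ^ k))‖ ≤ ε * 2 ^ (n + k) := by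
  intro ε hε
  -- Halász
  obtain ⟨CH', hHMT⟩ := Literature.NumberTheory.Sieve.halaszMontgomeryTenenbaum_holds
  set CH : ℝ := max CH' 1 with hCH
  have hCH0 : 0 < CH := by positivity
  have hCH' : CH' ≤ CH := le_max_left _ _
  -- `T` with `CH / √T ≤ ε / 2`
  set T : ℝ := max 1 ((2 * CH / ε) ^ 2) with hT
  have hT1 : 1 ≤ T := le_max_left _ _
  have hTroot : 2 * CH / ε ≤ Real.sqrt T := by
    rw [← Real.sqrt_sq (by positivity : (0 : ℝ) ≤ 2 * CH / ε)]
    exact Real.sqrt_le_sqrt (le_max_right _ _)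
  have hTterm : 1 / Real.sqrt T ≤ ε / (2 * CH) := by
    have h0 : 0 < 2 * CH / ε := by positivity
    rw [one_div, inv_le_comm₀ (lt_of_lt_of_le h0 hTroot) (by positivity)]
    calc (ε / (2 * CH))⁻¹ = 2 * CH / ε := by rw [inv_div]
      _ ≤ Real.sqrt T := hTroot
  -- `M₁ ≥ 0` with `(1 + M₁) e^{-M₁} ≤ ε / (2 CH)`
  set M₁ : ℝ := max 0 (2 * Real.log (4 * CH / ε)) with hM₁
  have hM₁0 : 0 ≤ M₁ := le_max_left _ _
  have hΦM₁ : (1 + M₁) * Real.exp (-M₁) ≤ ε / (2 * CH) := by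
    have h1 : (1 + M₁) * Real.exp (-M₁) = (1 + M₁) * Real.exp (-M₁ / 2) * Real.exp (-M₁ / 2) := by
      rw [mul_assoc, ← Real.exp_add]; ring_nf
    have h2 : (1 + M₁) * Real.exp (-M₁ / 2) ≤ 2 := by
      have h5 : M₁ / 2 + 1 ≤ Real.exp (M₁ / 2) := Real.add_one_le_exp _
      have h6 : Real.exp (M₁ / 2) * Real.exp (-M₁ / 2) = 1 := by
        rw [← Real.exp_add, show M₁ / 2 + -M₁ / 2 = 0 by ring, Real.exp_zero]
      have h7 : 0 < Real.exp (-M₁ / 2) := Real.exp_pos _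
      nlinarith
    have h3 : Real.exp (-M₁ / 2) ≤ ε / (4 * CH) := by
      have h4 : Real.log (4 * CH / ε) ≤ M₁ / 2 := by
        have := le_max_right 0 (2 * Real.log (4 * CH / ε)); rw [← hM₁] at this; linarith
      calc Real.exp (-M₁ / 2) ≤ Real.exp (-Real.log (4 * CH / ε)) :=
            Real.exp_le_exp.mpr (by linarith)
        _ = ε / (4 * CH) := by rw [Real.exp_neg, Real.exp_log (by positivity), inv_div]
    calc (1 + M₁) * Real.exp (-M₁) = (1 + M₁) * Real.exp (-M₁ / 2) * Real.exp (-M₁ / 2) := h1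
      _ ≤ 2 * (ε / (4 * CH)) :=
          mul_le_mul h2 h3 (Real.exp_pos _).le (by norm_num)
      _ = ε / (2 * CH) := by ring
  -- the analytic constants and `δ`
  obtain ⟨x₀, C₀, hx₀, hC₀, hdist⟩ := exists_pretentiousDistSq_ge
  set M₂ : ℝ := M₁ + C₀ with hM₂
  set δ : ℝ := Real.exp (-M₂) / 2 with hδ
  have hδ0 : 0 < δ := by positivity
  have hlog2 : 0 < Real.log 2 := Real.log_pos one_lt_two
  -- thresholds
  obtain ⟨Na, hNa⟩ := exists_nat_ge x₀
  obtain ⟨Nb, hNb⟩ := exists_nat_ge (Real.log (T + 4) / (δ * Real.log 2))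
  obtain ⟨nr, hnr⟩ := twisted_le_of_sq_eq_one hε
  obtain ⟨nz, hnz⟩ := twisted_norm_le_of_level_le 0 ε hε
  refine ⟨δ, hδ0, max (max Na Nb) (max nr nz), fun n hn k hk χ => ?_⟩
  have hnNa : Na ≤ n := le_trans ((le_max_left _ _).trans (le_max_left _ _)) hn
  have hnNb : Nb ≤ n := le_trans ((le_max_right _ _).trans (le_max_left _ _)) hn
  have hnnr : nr ≤ n := le_trans ((le_max_left _ _).trans (le_max_right _ _)) hn
  have hnnz : nz ≤ n := le_trans ((le_max_right _ _).trans (le_max_right _ _)) hn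
  by_cases hχ2 : χ ^ 2 = 1
  · -- real characters: the Green range
    rcases Nat.eq_zero_or_pos k with hk0 | hk1
    · subst hk0
      exact hnz n hnnz 0 le_rfl χ
    · exact hnr n hnnr k hk1 χ hχ2
  · -- complex characters: Halász
    haveI : NeZero (2 ^ k) := ⟨pow_ne_zero _ two_ne_zero⟩
    obtain ⟨f, hfm, hfb, hfval⟩ := exists_liouville_mul_char (2 ^ k) χ
    have hfp : ∀ p : ℕ, p.Prime → (f : ℕ → ℂ) p = -χ (p : ZMod (2 ^ k)) := by
      intro p hp
      rw [hfval, liouville_apply hp.ne_zero, cardFactors_apply_prime hp]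
      push_cast
      ring
    set x : ℝ := (2 : ℝ) ^ (n + k) with hx
    -- sizes: `x ≥ 2^n ≥ n ≥ Na ≥ x₀ ≥ 3`
    have hn2n : (n : ℝ) ≤ (2 : ℝ) ^ n := by exact_mod_cast (Nat.lt_two_pow_self).le
    have h2nx : (2 : ℝ) ^ n ≤ x := pow_le_pow_right₀ (by norm_num) (by omega)
    have hxx₀ : x₀ ≤ x := le_trans hNa (le_trans (by exact_mod_cast hnNa) (hn2n.trans h2nx))
    have hx3 : 3 ≤ x := hx₀.trans hxx₀
    have hn1 : (1 : ℝ) ≤ n := by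
      have : (3 : ℝ) ≤ n := le_trans hx₀ (le_trans hNa (by exact_mod_cast hnNa))
      linarith
    have hn0 : (0 : ℝ) < n := by linarith
    -- the stub's sum is `Σ_{m ∈ Icc 1 ⌊x⌋₊} f m`
    have hfloor : ⌊x⌋₊ = 2 ^ (n + k) := by
      rw [hx, show ((2 : ℝ) ^ (n + k)) = ((2 ^ (n + k) : ℕ) : ℝ) by push_cast; rfl, Nat.floor_natCast]
    have hsum : ∑ m : Fin (2 ^ (n + k)), ((liouville ((m : ℕ) + 1) : ℤ) : ℂ) *
        χ (((m : ℕ) + 1 : ℕ) : ZMod (2 ^ k)) = ∑ m ∈ Finset.Icc 1 ⌊x⌋₊, f m := by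
      have hIcc : Finset.Icc 1 (2 ^ (n + k)) = Finset.Ioc 0 (2 ^ (n + k)) := by
        ext m
        simp only [Finset.mem_Icc, Finset.mem_Ioc]
        omega
      rw [twistedSum_eq_Ioc, hfloor, hIcc]
      exact Finset.sum_congr rfl fun m _ => (hfval m).symm
    rw [hsum]
    -- Halász
    have hHal := hHMT f hfm hfb x T hx3 hT1
    -- the distance lower bound `M ≥ M₁`
    have hδn : Real.log (T + 4) ≤ δ * n * Real.log 2 := by
      have h := le_trans hNb (by exact_mod_cast hnNb : (Nb : ℝ) ≤ n)
      rw [div_le_iff₀ (by positivity)] at h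
      linarith
    have hM : M₁ ≤ minPretentiousDistSq f x T := by
      haveI : Nonempty (Set.Icc (-T) T) := ⟨⟨0, by simp; linarith⟩⟩
      refine le_ciInf fun t => ?_
      have ht : |(t : ℝ)| ≤ T := abs_le.mpr ⟨t.2.1, t.2.2⟩
      refine le_trans ?_ (hdist (2 ^ k) χ hχ2 f hfp x hxx₀ (t : ℝ))
      -- `log log x ≥ log (n log 2)`
      have hlogx : (n : ℝ) * Real.log 2 ≤ Real.log x := by
        rw [hx, Real.log_pow]; push_cast; nlinarith [(Nat.cast_nonneg k : (0 : ℝ) ≤ k)]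
      have hnlog2 : 0 < (n : ℝ) * Real.log 2 := by positivity
      have hll : Real.log ((n : ℝ) * Real.log 2) ≤ Real.log (Real.log x) := Real.log_le_log hnlog2 hlogx
      -- `log q + log(|t|+4) ≤ 2 δ n log 2 = e^{-M₂} n log 2`
      have hq : Real.log ((2 ^ k : ℕ) : ℝ) = k * Real.log 2 := by push_cast; rw [Real.log_pow]
      have hℒle : Real.log ((2 ^ k : ℕ) : ℝ) + Real.log (|(t : ℝ)| + 4) ≤ Real.exp (-M₂) * (n * Real.log 2) := by
        rw [hq]
        have h1 : (k : ℝ) * Real.log 2 ≤ δ * n * Real.log 2 := by nlinarith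
        have h2 : Real.log (|(t : ℝ)| + 4) ≤ Real.log (T + 4) :=
          Real.log_le_log (by linarith [abs_nonneg (t : ℝ)]) (by linarith)
        have h3 : 2 * (δ * n * Real.log 2) = Real.exp (-M₂) * (n * Real.log 2) := by rw [hδ]; ring
        linarith
      have hℒpos : 0 < Real.log ((2 ^ k : ℕ) : ℝ) + Real.log (|(t : ℝ)| + 4) := by
        have h1 : (0 : ℝ) ≤ Real.log ((2 ^ k : ℕ) : ℝ) := Real.log_natCast_nonneg _
        have h2 : 0 < Real.log (|(t : ℝ)| + 4) := Real.log_pos (by linarith [abs_nonneg (t : ℝ)])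
        linarith
      have hlogℒ : Real.log (Real.log ((2 ^ k : ℕ) : ℝ) + Real.log (|(t : ℝ)| + 4)) ≤
          -M₂ + Real.log ((n : ℝ) * Real.log 2) := by
        calc Real.log (Real.log ((2 ^ k : ℕ) : ℝ) + Real.log (|(t : ℝ)| + 4))
            ≤ Real.log (Real.exp (-M₂) * (n * Real.log 2)) := Real.log_le_log hℒpos hℒle
          _ = -M₂ + Real.log ((n : ℝ) * Real.log 2) := by
              rw [Real.log_mul (Real.exp_pos _).ne' hnlog2.ne', Real.log_exp]
      rw [hM₂] at hlogℒ
      linarith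
    -- assemble
    have hΦ : (1 + minPretentiousDistSq f x T) * Real.exp (-minPretentiousDistSq f x T) ≤ ε / (2 * CH) :=
      (Literature.NumberTheory.LFunctions.Tao2016.one_add_mul_exp_neg_le hM₁0 hM).trans hΦM₁
    have hx0 : 0 ≤ x := by positivity
    have hinner0 : 0 ≤ (1 + minPretentiousDistSq f x T) * Real.exp (-minPretentiousDistSq f x T)
        + 1 / Real.sqrt T := by
      have : 0 ≤ minPretentiousDistSq f x T := hM₁0.trans hM
      positivity
    calc ‖∑ m ∈ Finset.Icc 1 ⌊x⌋₊, f m‖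
        ≤ CH' * x * ((1 + minPretentiousDistSq f x T) * Real.exp (-minPretentiousDistSq f x T)
            + 1 / Real.sqrt T) := hHal
      _ ≤ CH * x * ((1 + minPretentiousDistSq f x T) * Real.exp (-minPretentiousDistSq f x T)
            + 1 / Real.sqrt T) := by gcongr
      _ ≤ CH * x * (ε / (2 * CH) + ε / (2 * CH)) := by gcongr
      _ = ε * x := by field_simp; ring
      _ = ε * 2 ^ (n + k) := by rw [hx]

end Summit.ValiantsHypothesis.ValiantsHypothesis.Theorems.LiouvilleSarnak.AlignedTypeI.CharactersModTwoN
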